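import Mathlib
import Literature.Computability.Complexity.ExtMonotoneGates
import Summits.PneNP.PneNP.Theorems.ConvexRankGatesLinAlgGateBlindDefs
import Summits.PneNP.PneNP.Theorems.ConvexRankGatesLinAlgGateBlindPlanting
import Summits.PneNP.PneNP.Theorems.ConvexRankGatesLinAlgGateBlindDenseRegime
import Summits.PneNP.PneNP.Theorems.ConvexRankGatesLinAlgGateBlindDenseRegimeAux
import Summits.PneNP.PneNP.Theorems.ConvexRankGatesLinAlgGateBlindPermSmallDimAux

/-!
# SG for monotone term gates of small fan-in, whatever their algebra (corollary of the planting theorem; crux `LinAlgGateBlind`, stmt-PneNP-10681, route ConvexRankGates)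

The single-gate statements of the crux chain (`stub_sgPerm`, `stub_sgGRank` of line
`dnf-invariant-wide-gates-see-small-cliques`; `stub_sgHallCover`, `stub_sgCancelling` of line
`konig-atoms-cancellation-split`) ask, at `δ = 1/8` and for every `c`, eventually in `m`, for
`SGAt m P (lOf m) (kOf m) (qOf m) (epsOf c m)` for a class `P` of WIDE monotone gates (PERM, GRANK,
König) of dimension `≤ m^c` and UNBOUNDED fan-in over clique atoms of `≤ lOf m` vertices. This file
records the complementary trivial range in the FAN-IN: the rejection region of ANY monotone term gate
of fan-in `n'` is covered from inside by the `≤ 2^{n'}` all-off events of its false points, so the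
planting theorem `sg_of_maxtermCover` (`…Theorems.ConvexRankGatesLinAlgGateBlindPlanting`) settles SG
for every monotone gate class of fan-in `≤ m^{3/4}/2`, with no hypothesis on the algebra of the gate:

* `sgAt_monotone_of_fanIn_budget` — non-asymptotic form under the two planting budgets
  (`(ν·C(l,2))^t·C(m-t,k-t) ≤ ε·C(m,k)`, `2^B·(1/2)^{ν+1}·#𝒱(l) < ε`), for the class
  `{g | Monotone g.2 ∧ g.1 ≤ B}`.
* `sgAt_monotone_of_fanIn_le` — for every `c`, eventually in `m`, for every `B` with
  `2B ≤ m^{3/4}`: `SGAt m {g | Monotone g.2 ∧ g.1 ≤ B} (lOf m) (kOf m) (qOf m) (epsOf c m)`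
  (budgets `permSmallDim_budgets`, dense-regime facts `stub_denseRegime`).

Consequently a term gate violating any of the four research stubs reads more than `m^{3/4}/2`
distinct atoms (companions: `sgAt_perm_of_dim_le` — PERM of dimension `≤ m^{3/8-o(1)}`;
`sgAt_hallCover_of_dim_le` — Hall-cover gates of dimension `≤ m^{3/4}/4`). Sources: Alon–Boppana 1987
§3, Razborov 1985; the planting theorem is the tree's. [folklore]
-/

noncomputable section

namespace Summit.PneNP.PneNP.Theorems

open scoped BigOperators
open Finset Filter Literature.Computability.Complexity Razborov
open Summit.PneNP.PneNP.Cruxes.LinAlgGateBlind.DnfInvariantWideGatesSeeSmallCliques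

/-- **SG for monotone term gates of fan-in `≤ B` under the two planting budgets.** Let `0 ≤ q ≤ 1`,
`1 - q^{C(l,2)} ≤ 1/2`, `0 < ε`, `2t ≤ l`, `(ν·C(l,2))^t · C(m-t, k-t) ≤ ε·C(m,k)` and
`2^B · (1/2)^{ν+1} · #𝒱(l) < ε`. Then `SGAt m {g | Monotone g.2 ∧ g.1 ≤ B} l k q ε`: for a monotone
gate `g` of fan-in `n' ≤ B` over atoms `X_a`, `O x = 0` iff for the false point `w = (⌈X_a⌉(x))_a`
every atom with `w_a = 0` is absent; the all-off events `D_w` of the `≤ 2^{n'}` false points `w` lie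
inside the rejection region (monotonicity) and cover it, so `sg_of_maxtermCover` with
`η = ε/#𝒱(l)` applies. [folklore] -/
theorem sgAt_monotone_of_fanIn_budget : ∀ (m l k B ν t : ℕ) (q ε : ℝ), 0 ≤ q → q ≤ 1 →
    1 - q ^ (l.choose 2) ≤ 1 / 2 → 0 < ε → 2 * t ≤ l →
    (((ν * l.choose 2) ^ t * (m - t).choose (k - t) : ℕ) : ℝ) ≤ ε * (m.choose k : ℝ) →
    (2 : ℝ) ^ B * (1 / 2) ^ (ν + 1) * #(smallSets (Fin m) l) < ε →
    SGAt m (fun g => Monotone g.2 ∧ g.1 ≤ B) l k q ε := by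
  intro m l k B ν t q ε hq0 hq1 hql hε htl hpos hfrag O hO
  classical
  obtain ⟨g, ⟨hmono, hB⟩, X, hX, hOX⟩ := hO
  have hV : (0 : ℝ) < #(smallSets (Fin m) l) := Nat.cast_pos.2 (card_pos.2 ⟨∅, empty_mem_smallSets l⟩)
  -- index the cover by the false points of `g`
  set J := {w : Fin g.1 → Bool // g.2 w = false} with hJ
  set N := Nat.card J with hNdef
  set e : J ≃ Fin N := Finite.equivFin J with he
  set 𝓛 : Fin N → Finset (Finset (Fin m)) := fun j =>
    (univ.filter fun a => (e.symm j).1 a = false).image X with h𝓛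
  have hNle : (N : ℝ) ≤ (2 : ℝ) ^ B := by
    have h1 : N ≤ Nat.card (Fin g.1 → Bool) :=
      Nat.card_le_card_of_injective (Subtype.val : J → (Fin g.1 → Bool)) Subtype.val_injective
    have h2 : Nat.card (Fin g.1 → Bool) = 2 ^ g.1 := by
      rw [Nat.card_eq_fintype_card, Fintype.card_fun, Fintype.card_bool, Fintype.card_fin]
    have h3 : (2 : ℕ) ^ g.1 ≤ 2 ^ B := Nat.pow_le_pow_right (by norm_num) hB
    exact_mod_cast (h1.trans_eq h2).trans h3
  have hN : (N : ℝ) * (1 / 2) ^ (ν + 1) < ε / #(smallSets (Fin m) l) := by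
    rw [lt_div_iff₀ hV]
    calc (N : ℝ) * (1 / 2) ^ (ν + 1) * #(smallSets (Fin m) l)
        ≤ (2 : ℝ) ^ B * (1 / 2) ^ (ν + 1) * #(smallSets (Fin m) l) := by gcongr
      _ < ε := hfrag
  have h1 : ∀ j, 𝓛 j ⊆ smallSets (Fin m) l := by
    intro j Y hY
    obtain ⟨a, -, rfl⟩ := mem_image.1 hY
    exact hX a
  have h2 : ∀ x, O x = false → ∃ j, ∀ Y ∈ 𝓛 j, ¬ CliquePresent Y x := by
    intro x hx
    rw [hOX x] at hx
    refine ⟨e ⟨fun a => atomB (X a) x, hx⟩, fun Y hY => ?_⟩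
    obtain ⟨a, ha, rfl⟩ := mem_image.1 hY
    rw [mem_filter, Equiv.symm_apply_apply] at ha
    simpa [atomB] using ha.2
  have h3 : ∀ j x, (∀ Y ∈ 𝓛 j, ¬ CliquePresent Y x) → O x = false := by
    intro j x hall
    have hle : (fun a => atomB (X a) x) ≤ (e.symm j).1 := by
      intro a
      show atomB (X a) x ≤ (e.symm j).1 a
      by_cases hw : (e.symm j).1 a = false
      · have : atomB (X a) x = false := by
          simpa [atomB] using hall (X a) (mem_image_of_mem X (mem_filter.2 ⟨mem_univ a, hw⟩))
        rw [this]
        exact Bool.false_le _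
      · rw [Bool.not_eq_false] at hw
        rw [hw]
        exact Bool.le_true _
    have := hmono hle
    rw [(e.symm j).2] at this
    rw [hOX x]
    exact Bool.eq_false_iff.2 fun h => Bool.false_ne_true (le_antisymm (Bool.false_le _) (h ▸ this))
  obtain ⟨𝒜, h𝒜, hP, hNg⟩ := sg_of_maxtermCover m l k N ν t q (ε / #(smallSets (Fin m) l)) O 𝓛 h1 h2 h3
    hq0 hq1 hql (div_pos hε hV) hN htl
  refine ⟨𝒜, h𝒜, ?_, hNg.trans_eq (mul_div_cancel₀ ε hV.ne')⟩
  calc (#(lostPos m k O 𝒜) : ℝ) ≤ (((ν * l.choose 2) ^ t * (m - t).choose (k - t) : ℕ) : ℝ) := by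
        exact_mod_cast hP
    _ ≤ ε * (m.choose k : ℝ) := hpos

open DenseRegime in
/-- **SG for monotone term gates of fan-in `≤ m^{3/4}/2`, at the parameters of the lines, whatever the
algebra of the gate.** For every `c`, eventually in `m`: for every `B` with `2B ≤ m^{3/4}`,
`SGAt m {g | Monotone g.2 ∧ g.1 ≤ B} (lOf m) (kOf m) (qOf m) (epsOf c m)` — every monotone term gate
reading at most `B` atoms of `≤ lOf m` vertices is `epsOf c m`-approximated, one-sidedly on
(bare `kOf m`-cliques, `G(m, qOf m)`), by a small-clique DNF. So a violator of `stub_sgPerm`,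
`stub_sgGRank`, `stub_sgHallCover` or `stub_sgCancelling` reads more than `m^{3/4}/2` atoms. Proof:
`sgAt_monotone_of_fanIn_budget` with `ν = ⌈m^{3/4}⌉₊`, `t = ⌊lOf m/2⌋`, `stub_denseRegime` and
`permSmallDim_budgets`. [folklore] -/
theorem sgAt_monotone_of_fanIn_le : ∀ c : ℕ, ∀ᶠ m : ℕ in atTop, ∀ B : ℕ,
    2 * (B : ℝ) ≤ (m : ℝ) ^ (3 / 4 : ℝ) →
      SGAt m (fun g => Monotone g.2 ∧ g.1 ≤ B) (lOf m) (kOf m) (qOf m) (epsOf c m) := by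
  intro c
  filter_upwards [stub_denseRegime c, permSmallDim_budgets c, eventually_ge_atTop 1] with m hD hB hm B hBm
  obtain ⟨-, -, -, hq0, hq1, -, -, -, -, hhalf⟩ := hD
  obtain ⟨hpos, hfrag⟩ := hB
  have hε : 0 < epsOf c m := by
    rw [epsOf_eq]
    positivity
  have hN : (2 : ℝ) ^ B ≤ (2 : ℝ) ^ ((m : ℝ) ^ (3 / 4 : ℝ) / 2) := by
    rw [← Real.rpow_natCast]
    exact Real.rpow_le_rpow_of_exponent_le one_le_two (by linarith)
  refine sgAt_monotone_of_fanIn_budget m (lOf m) (kOf m) B ⌈(m : ℝ) ^ (3 / 4 : ℝ)⌉₊ (lOf m / 2)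
    (qOf m) (epsOf c m) hq0 hq1 (by linarith) hε (Nat.mul_div_le (lOf m) 2) hpos ?_
  calc (2 : ℝ) ^ B * (1 / 2) ^ (⌈(m : ℝ) ^ (3 / 4 : ℝ)⌉₊ + 1) * #(smallSets (Fin m) (lOf m))
      ≤ (2 : ℝ) ^ ((m : ℝ) ^ (3 / 4 : ℝ) / 2) * (1 / 2) ^ (⌈(m : ℝ) ^ (3 / 4 : ℝ)⌉₊ + 1) *
        #(smallSets (Fin m) (lOf m)) := by gcongr
    _ < epsOf c m := hfrag

end Summit.PneNP.PneNP.Theorems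

end
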